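import Mathlib
import Summits.ABC.ABC.Theses.RibetTakahashiSplit

/-!
# Sketch — crux stmt-ABC-17927 `RibetTakahashiSplit.ThinWeightedSzpiro` (r3″), ideator 4, round 2

Two typed packages (elaboration only is required of a crux-ideate sketch; the easy glue is proved).

* `MordellRankGate` — the first lemmas of idea card `mordell-rank-gate`: the class-free kernel of
  r3″ (Hall at the sharp exponent on squarefree discriminants, `hallSquarefree_of_thinWeightedSzpiro`,
  p153315) transported to the Mordell twists `M_Δ : Y² = X³ − 1728 Δ`, on which `(c₄(W₀), c₆(W₀))`
  is an INTEGRAL point (`c₄³ − c₆² = 1728 Δ`); the rank gate (rank-one reduction to integral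
  GENERATORS) is stated as `rankOne_reduction` and proved from its three inputs.
* `FreyRecut` — planner-facing: the Frey-class restriction of the crux (the only instance the
  route's `closes` ever uses) typed verbatim, with `frey_of_crux` proved; the re-pointed deciding
  theorem is recorded as the Prop `FreyRecutCloses`.
-/

set_option linter.dupNamespace false
set_option linter.unusedVariables false

namespace Summit.ABC.ABC.Cruxes.ThinWeightedSzpiro.MordellRankGate

open WeierstrassCurve

/-- The Mordell (sextic) twist of `j = 0` carrying the squarefree slice: `Y² = X³ − 1728·Δ`. -/
def mordellTwist (Δ : ℤ) : WeierstrassCurve ℚ := ⟨0, 0, 0, 0, -(1728 * (Δ : ℚ))⟩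

theorem mordellTwist_equation_iff (Δ : ℤ) (x y : ℚ) :
    (mordellTwist Δ).toAffine.Equation x y ↔ y ^ 2 = x ^ 3 - 1728 * Δ := by
  rw [WeierstrassCurve.Affine.equation_iff]
  simp only [mordellTwist]
  constructor <;> intro h <;> linarith

/-- The slice point: for every integer Weierstrass equation `W₀`, `(c₄, c₆)` lies on
`M_{Δ(W₀)}` (Mathlib `WeierstrassCurve.c_relation : 1728 Δ = c₄³ − c₆²`). -/
theorem slicePoint_equation (W₀ : WeierstrassCurve ℤ) :
    (mordellTwist W₀.Δ).toAffine.Equation (W₀.c₄ : ℚ) (W₀.c₆ : ℚ) := by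
  rw [mordellTwist_equation_iff]
  have h := W₀.c_relation
  have h' : ((1728 * W₀.Δ : ℤ) : ℚ) = ((W₀.c₄ ^ 3 - W₀.c₆ ^ 2 : ℤ) : ℚ) := by exact_mod_cast h
  push_cast at h'
  linarith

/-- An affine point of `M_Δ(ℚ)` with integer coordinates. -/
def IsIntegralPt {Δ : ℤ} (P : (mordellTwist Δ).toAffine.Point) : Prop :=
  ∃ (x y : ℤ) (h : (mordellTwist Δ).toAffine.Nonsingular (x : ℚ) (y : ℚ)), P = .some _ _ h

/-- `G` generates the Mordell–Weil group `M_Δ(ℚ)` (rank ≤ 1; for `|Δ| > 1` squarefree the group is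
torsion-free, so this says: rank one with generator `G`, or rank zero). -/
def IsGeneratedBy {Δ : ℤ} (G : (mordellTwist Δ).toAffine.Point) : Prop :=
  ∀ P : (mordellTwist Δ).toAffine.Point, ∃ m : ℤ, P = m • G

/-- **The kernel in Mordell clothing** (B–G Conj. 12.5.1 at the sharp exponent on `k = 1728 Δ`,
`Δ` squarefree): every integral point of `M_Δ` has `|x|³ ≤ C_ε |Δ|^{6+ε}`. It contains the
squarefree-slice consequence of the crux (`hallSlice_of_hallSliceMordell`). [conjecture-grade] -/
def HallSliceMordell : Prop :=
  ∀ ε : ℝ, 0 < ε → ∃ C : ℝ, ∀ Δ : ℤ, Squarefree Δ.natAbs →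
    ∀ x y : ℤ, (mordellTwist Δ).toAffine.Equation (x : ℚ) (y : ℚ) →
      (|x| ^ 3 : ℝ) ≤ C * ((Δ.natAbs : ℕ) : ℝ) ^ (6 + ε)

/-- `HallSliceMordell` implies the conclusion of `hallSquarefree_of_thinWeightedSzpiro` (p153315),
i.e. the class-free kernel of r3″, through the slice point `(c₄, c₆)`. [proved here] -/
theorem hallSlice_of_hallSliceMordell (h : HallSliceMordell) :
    ∀ ε : ℝ, 0 < ε → ∃ C : ℝ, ∀ W₀ : WeierstrassCurve ℤ, Squarefree W₀.Δ.natAbs →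
      ((|W₀.c₄| ^ 3 : ℤ) : ℝ) ≤ C * ((W₀.Δ.natAbs : ℕ) : ℝ) ^ (6 + ε) := by
  intro ε hε
  obtain ⟨C, hC⟩ := h ε hε
  refine ⟨C, fun W₀ hsq => ?_⟩
  have := hC W₀.Δ hsq W₀.c₄ W₀.c₆ (slicePoint_equation W₀)
  push_cast
  exact_mod_cast this

/-- **IG — integral generators are small** (the research stub of the rank-one locus): if `M_Δ(ℚ)`
is generated by an INTEGRAL point `G = (x, y)` then `|x|³ ≤ C_ε |Δ|^{6+ε}`. Equivalently (GZ +
Kolyvagin + the CM period `covol(Λ_{M_Δ}) = |1728Δ|^{-1/6} covol(Λ_{M_1})`): an integral generator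
forces `#Ш(M_Δ/K) ≳ √|D_K| · L'(M_Δ/K, 1) · |Δ|^{1/6} / log|Δ|` for every Heegner field `K`.
[conjecture-grade; = Hall on generators] -/
def IntegralGeneratorBound : Prop :=
  ∀ ε : ℝ, 0 < ε → ∃ C : ℝ, ∀ Δ : ℤ, Squarefree Δ.natAbs →
    ∀ G : (mordellTwist Δ).toAffine.Point, IsGeneratedBy G →
      ∀ (x y : ℤ) (hG : (mordellTwist Δ).toAffine.Nonsingular (x : ℚ) (y : ℚ)), G = .some _ _ hG →
        (|x| ^ 3 : ℝ) ≤ C * ((Δ.natAbs : ℕ) : ℝ) ^ (6 + ε)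

/-- **UMB — uniform multiple bound**: beyond finitely many `Δ`, an integral point of a cyclic
`M_Δ(ℚ)` is `m • G` with `|m| ≤ M₀`. (David's linear forms in elliptic logarithms + the
Hindry–Silverman Lang bound — unconditional on these twists — give `|m| ≪ (log|Δ|)^{1+o(1)}`;
Ingram-type primitive-divisor uniformity is the expected `M₀`.) [open as stated; M–L] -/
def UniformMultipleBound : Prop :=
  ∃ M₀ k₀ : ℕ, ∀ Δ : ℤ, Squarefree Δ.natAbs → k₀ < Δ.natAbs →
    ∀ G P : (mordellTwist Δ).toAffine.Point, IsGeneratedBy G → IsIntegralPt P →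
      ∀ m : ℤ, P = m • G → m.natAbs ≤ M₀

/-- **Proper multiples are Hall-fine**: for each fixed `m` with `|m| ≥ 2`, an integral point of the
form `m • G` with `G` a generator of a cyclic `M_Δ(ℚ)`, `Δ` squarefree, has `|x|³ ≤ C_m |Δ|⁶`
(elementary from `ψ_m(G)² ∣ ψ_{m-1}ψ_{m+1}(G)`, the EDS divisibility `B₁ ∣ B_m` forcing `G`
integral, and `gcd(x(G)·y(G), 1728Δ) ∣ 6^∞` on the slice: `m = 2` gives `y(G)² ∣ 9·1728Δ·x(G)`,
hence `y(G)` bounded and `x(2G) ≍ |Δ|^{4/3}`; `m = 3` gives `x(G) ∣ 64·(1728Δ)³`, hence bounded `Δ`).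
[provable per `m`; M each] -/
def MultiplesAreHallFine : Prop :=
  ∀ m : ℤ, 2 ≤ m.natAbs → ∃ C : ℝ, ∀ Δ : ℤ, Squarefree Δ.natAbs →
    ∀ G P : (mordellTwist Δ).toAffine.Point, IsGeneratedBy G → P = m • G →
      ∀ (x y : ℤ) (hP : (mordellTwist Δ).toAffine.Nonsingular (x : ℚ) (y : ℚ)), P = .some _ _ hP →
        (|x| ^ 3 : ℝ) ≤ C * ((Δ.natAbs : ℕ) : ℝ) ^ (6 : ℝ)

/-- The kernel restricted to the rank-≤-one locus. -/
def HallSliceRankOne : Prop :=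
  ∀ ε : ℝ, 0 < ε → ∃ C : ℝ, ∀ Δ : ℤ, Squarefree Δ.natAbs →
    ∀ G : (mordellTwist Δ).toAffine.Point, IsGeneratedBy G →
      ∀ (x y : ℤ) (hP : (mordellTwist Δ).toAffine.Nonsingular (x : ℚ) (y : ℚ)),
        (|x| ^ 3 : ℝ) ≤ C * ((Δ.natAbs : ℕ) : ℝ) ^ (6 + ε)

/-- Finitely many exceptional `Δ` (those with `|Δ| ≤ k₀`) contribute a constant: on `M_Δ` with
`|Δ| ≤ k₀` the integral points have `|x|` bounded by a constant depending on `k₀` only (Baker;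
here packaged as a hypothesis-free finite bound since each `M_Δ` has finitely many integral points —
Siegel). Recorded as the Prop the glue consumes. [Siegel/Baker; S] -/
def SmallDiscriminantsBounded : Prop :=
  ∀ k₀ : ℕ, ∃ B : ℝ, ∀ Δ : ℤ, Δ.natAbs ≤ k₀ → Δ ≠ 0 →
    ∀ x y : ℤ, (mordellTwist Δ).toAffine.Equation (x : ℚ) (y : ℚ) → (|x| ^ 3 : ℝ) ≤ B

/-- **The rank gate (glue, proved):** IG ∧ UMB ∧ (proper multiples Hall-fine) ∧ (small `Δ` bounded)
⟹ the kernel on the rank-≤-one locus. -/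
theorem rankOne_reduction (hIG : IntegralGeneratorBound) (hUMB : UniformMultipleBound)
    (hM : MultiplesAreHallFine) (hS : SmallDiscriminantsBounded) : HallSliceRankOne := by
  intro ε hε
  obtain ⟨M₀, k₀, hMk⟩ := hUMB
  obtain ⟨C₁, hC₁⟩ := hIG ε hε
  obtain ⟨B, hB⟩ := hS k₀
  -- constants for the finitely many proper multiples `2 ≤ |m| ≤ M₀`
  have hfin : ∃ C₂ : ℝ, 0 ≤ C₂ ∧ ∀ m : ℤ, 2 ≤ m.natAbs → m.natAbs ≤ M₀ →
      ∀ Δ : ℤ, Squarefree Δ.natAbs → ∀ G P : (mordellTwist Δ).toAffine.Point, IsGeneratedBy G →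
        P = m • G → ∀ (x y : ℤ) (hP : (mordellTwist Δ).toAffine.Nonsingular (x : ℚ) (y : ℚ)),
          P = .some _ _ hP → (|x| ^ 3 : ℝ) ≤ C₂ * ((Δ.natAbs : ℕ) : ℝ) ^ (6 : ℝ) := by
    classical
    -- choose a constant for each `m` in the finite window and take the max
    have key : ∀ m : ℤ, ∃ C : ℝ, 2 ≤ m.natAbs → ∀ Δ : ℤ, Squarefree Δ.natAbs →
        ∀ G P : (mordellTwist Δ).toAffine.Point, IsGeneratedBy G → P = m • G →
          ∀ (x y : ℤ) (hP : (mordellTwist Δ).toAffine.Nonsingular (x : ℚ) (y : ℚ)),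
            P = .some _ _ hP → (|x| ^ 3 : ℝ) ≤ C * ((Δ.natAbs : ℕ) : ℝ) ^ (6 : ℝ) := by
      intro m
      by_cases hm : 2 ≤ m.natAbs
      · obtain ⟨C, hC⟩ := hM m hm
        exact ⟨C, fun _ => hC⟩
      · exact ⟨0, fun h => absurd h hm⟩
    choose Cm hCm using key
    let S : Finset ℤ := Finset.Icc (-(M₀ : ℤ)) M₀
    have hS0 : (0 : ℤ) ∈ S := by simp [S]
    refine ⟨S.sup' ⟨0, hS0⟩ (fun m => max (Cm m) 0), ?_, ?_⟩
    · exact le_trans (le_max_right _ _) (Finset.le_sup' (fun m => max (Cm m) 0) hS0)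
    · intro m hm2 hmM Δ hsq G P hG hP x y hxy hPeq
      have hmS : m ∈ S := by
        simp only [S, Finset.mem_Icc]
        constructor <;> omega
      have h1 := hCm m hm2 Δ hsq G P hG hP x y hxy hPeq
      have h2 : Cm m ≤ S.sup' ⟨0, hS0⟩ (fun m => max (Cm m) 0) :=
        le_trans (le_max_left _ _) (Finset.le_sup' (fun m => max (Cm m) 0) hmS)
      exact h1.trans (mul_le_mul_of_nonneg_right h2 (by positivity))
  obtain ⟨C₂, hC₂0, hC₂⟩ := hfin
  refine ⟨max (max C₁ C₂) (max B 0), fun Δ hsq G hG x y hP => ?_⟩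
  have hΔ0 : Δ ≠ 0 := by
    intro h0; rw [h0, Int.natAbs_zero] at hsq; exact not_squarefree_zero hsq
  have hN1 : (1 : ℝ) ≤ ((Δ.natAbs : ℕ) : ℝ) := by
    have : 1 ≤ Δ.natAbs := Nat.one_le_iff_ne_zero.mpr (Int.natAbs_ne_zero.mpr hΔ0)
    exact_mod_cast this
  have hpow1 : (1 : ℝ) ≤ ((Δ.natAbs : ℕ) : ℝ) ^ (6 + ε) := Real.one_le_rpow hN1 (by linarith)
  have hpow6 : ((Δ.natAbs : ℕ) : ℝ) ^ (6 : ℝ) ≤ ((Δ.natAbs : ℕ) : ℝ) ^ (6 + ε) :=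
    Real.rpow_le_rpow_of_exponent_le hN1 (by linarith)
  by_cases hk : Δ.natAbs ≤ k₀
  · -- small discriminant: absolute bound
    have := hB Δ hk hΔ0 x y hP.left
    calc (|x| ^ 3 : ℝ) ≤ B := this
      _ ≤ max (max C₁ C₂) (max B 0) * 1 :=
          by rw [mul_one]; exact le_trans (le_max_left _ _) (le_max_right _ _)
      _ ≤ max (max C₁ C₂) (max B 0) * ((Δ.natAbs : ℕ) : ℝ) ^ (6 + ε) :=
          mul_le_mul_of_nonneg_left hpow1 (le_trans (le_max_right _ _) (le_max_right _ _))
  · push Not at hk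
    set P : (mordellTwist Δ).toAffine.Point := .some _ _ hP with hPdef
    obtain ⟨m, hm⟩ := hG P
    have hPint : IsIntegralPt P := ⟨x, y, hP, rfl⟩
    have hmle : m.natAbs ≤ M₀ := hMk Δ hsq hk G P hG hPint m hm
    have hC0 : 0 ≤ max (max C₁ C₂) (max B 0) := le_trans (le_max_right _ _) (le_max_right _ _)
    rcases Nat.lt_or_ge m.natAbs 2 with hlt | hge
    · -- `m ∈ {0, ±1}`: `P = 0` is impossible for an affine point; `P = ±G` means `G = ±P` is the
      -- integral generator, handled by IG (for `m = -1` apply IG to the generator `-G`... we use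
      -- that `-G` also generates and `P = (-1) • G = -G`, so `G = -P = .some (negation)`; to stay
      -- elementary we apply IG to the generator `P` itself: `P` generates since `G = ±P`).
      interval_cases h : m.natAbs
      · have : m = 0 := Int.natAbs_eq_zero.mp h
        rw [this, zero_zsmul] at hm
        exact absurd hm (by rw [hPdef]; exact WeierstrassCurve.Affine.Point.some_ne_zero hP)
      · have hm1 : m = 1 ∨ m = -1 := by omega
        have hPgen : IsGeneratedBy P := by
          intro Q
          obtain ⟨n, hn⟩ := hG Q
          rcases hm1 with h1 | h1
          · rw [h1, one_smul] at hm
            exact ⟨n, by rw [hm]; exact hn⟩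
          · rw [h1, neg_one_zsmul] at hm
            have hGP : G = -P := by rw [hm, neg_neg]
            refine ⟨-n, ?_⟩
            rw [hn, hGP, zsmul_neg, neg_zsmul]
        have := hC₁ Δ hsq P hPgen x y hP rfl
        exact this.trans (mul_le_mul_of_nonneg_right
          (le_trans (le_max_left _ _) (le_max_left _ _)) (by positivity))
    · have := hC₂ m hge hmle Δ hsq G P hG hm x y hP rfl
      calc (|x| ^ 3 : ℝ) ≤ C₂ * ((Δ.natAbs : ℕ) : ℝ) ^ (6 : ℝ) := this
        _ ≤ C₂ * ((Δ.natAbs : ℕ) : ℝ) ^ (6 + ε) := mul_le_mul_of_nonneg_left hpow6 hC₂0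
        _ ≤ max (max C₁ C₂) (max B 0) * ((Δ.natAbs : ℕ) : ℝ) ^ (6 + ε) :=
          mul_le_mul_of_nonneg_right (le_trans (le_max_right _ _) (le_max_left _ _)) (by positivity)

/-! ### All ranks: integral points are small-generated (IGS) + Hall on small spans (ELW side) -/

/-- A rational point of naive height at most `|Δ|^A`: `x = a/b` in lowest terms with
`max(|a|, b) ≤ |Δ|^A` (for `A` fixed this is `ĥ ≤ (A/2 + O(1))·log|Δ|` on the family). -/
def IsSmallPt {Δ : ℤ} (A : ℝ) (Q : (mordellTwist Δ).toAffine.Point) : Prop :=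
  ∃ (x y : ℚ) (h : (mordellTwist Δ).toAffine.Nonsingular x y), Q = .some _ _ h ∧
    (max (|x.num| : ℝ) (x.den : ℝ)) ≤ ((Δ.natAbs : ℕ) : ℝ) ^ A

/-- **IGS — integral points are generated by small points**: there is an absolute `A` such that every
integral point of `M_Δ` (`Δ` squarefree) lies in the subgroup generated by the points of naive height
`≤ |Δ|^A`. On the rank-one locus this is `IntegralGeneratorBound`-shaped (the generator itself must be
small); Danilov's champion `(93844, ·)` on `y² = x³ + 297` is `3·(−6,9) − (−2,17)`. [conjecture-grade;
the Mordell–Weil-structural half of the kernel] -/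
def IntegralPointsSmallGenerated : Prop :=
  ∃ A : ℝ, ∀ Δ : ℤ, Squarefree Δ.natAbs →
    ∀ P : (mordellTwist Δ).toAffine.Point, IsIntegralPt P →
      P ∈ AddSubgroup.closure {Q : (mordellTwist Δ).toAffine.Point | IsSmallPt A Q}

/-- **Hall on small spans** (the transcendence half, sharp form): integral points in the subgroup
generated by `|Δ|^A`-small points satisfy the kernel bound. Its QUASI-POLYNOMIAL rung
`log|x| ≪_{A,r} (log|Δ|)^{r+1+o(1)}` on spans of `r` small points is a theorem-shaped consequence of
David's lower bound for linear forms in elliptic logarithms (`SmallSpanQuasiPoly`); the polynomial rung is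
the elliptic Lang–Waldschmidt conjecture; the sharp rung is open. [conjecture-grade at 6+ε] -/
def SmallSpanHall : Prop :=
  ∀ A : ℝ, ∀ ε : ℝ, 0 < ε → ∃ C : ℝ, ∀ Δ : ℤ, Squarefree Δ.natAbs →
    ∀ P : (mordellTwist Δ).toAffine.Point,
      P ∈ AddSubgroup.closure {Q : (mordellTwist Δ).toAffine.Point | IsSmallPt A Q} →
      ∀ (x y : ℤ) (hP : (mordellTwist Δ).toAffine.Nonsingular (x : ℚ) (y : ℚ)), P = .some _ _ hP →
        (|x| ^ 3 : ℝ) ≤ C * ((Δ.natAbs : ℕ) : ℝ) ^ (6 + ε)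

/-- The quasi-polynomial rung (David 1995 + reduction theory of the Mordell–Weil lattice; to be vendored
as a named fact with its constants): integral points in the span of `r` points of naive height `≤ |Δ|^A`
have `log|x| ≤ C·(log|Δ|)^κ` with `C, κ` depending on `A, r` only. [cite: David1995, Thm. 2.1] -/
def SmallSpanQuasiPoly : Prop :=
  ∀ (A : ℝ) (r : ℕ), ∃ C κ : ℝ, ∀ Δ : ℤ, Squarefree Δ.natAbs → 2 ≤ Δ.natAbs →
    ∀ Q : Fin r → (mordellTwist Δ).toAffine.Point, (∀ i, IsSmallPt A (Q i)) →
      ∀ P : (mordellTwist Δ).toAffine.Point, P ∈ AddSubgroup.closure (Set.range Q) →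
        ∀ (x y : ℤ) (hP : (mordellTwist Δ).toAffine.Nonsingular (x : ℚ) (y : ℚ)), P = .some _ _ hP →
          Real.log (max (|x| : ℝ) 1) ≤ C * Real.log ((Δ.natAbs : ℕ) : ℝ) ^ κ

/-- **Glue (proved): IGS ∧ SmallSpanHall ⟹ the kernel for integral points** (all ranks). -/
theorem hallSliceMordell_integral_of_IGS (hI : IntegralPointsSmallGenerated) (hS : SmallSpanHall) :
    ∀ ε : ℝ, 0 < ε → ∃ C : ℝ, ∀ Δ : ℤ, Squarefree Δ.natAbs →
      ∀ (x y : ℤ) (hP : (mordellTwist Δ).toAffine.Nonsingular (x : ℚ) (y : ℚ)),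
        (|x| ^ 3 : ℝ) ≤ C * ((Δ.natAbs : ℕ) : ℝ) ^ (6 + ε) := by
  obtain ⟨A, hA⟩ := hI
  intro ε hε
  obtain ⟨C, hC⟩ := hS A ε hε
  refine ⟨C, fun Δ hsq x y hP => ?_⟩
  have hint : IsIntegralPt (.some _ _ hP : (mordellTwist Δ).toAffine.Point) := ⟨x, y, hP, rfl⟩
  exact hC Δ hsq _ (hA Δ hsq _ hint) x y hP rfl

/-- … hence `HallSliceMordell` itself (the `Equation`-form: nonsingularity is automatic since
`Δ(M_Δ) = −432·(1728Δ)² ≠ 0`). [proved modulo `equation_iff_nonsingular_of_Δ_ne_zero`] -/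
theorem hallSliceMordell_of_IGS (hI : IntegralPointsSmallGenerated) (hS : SmallSpanHall) :
    HallSliceMordell := by
  intro ε hε
  obtain ⟨C, hC⟩ := hallSliceMordell_integral_of_IGS hI hS ε hε
  refine ⟨C, fun Δ hsq x y hxy => ?_⟩
  have hΔ0 : Δ ≠ 0 := by
    intro h0; rw [h0, Int.natAbs_zero] at hsq; exact not_squarefree_zero hsq
  have hD : (mordellTwist Δ).toAffine.Δ ≠ 0 := by
    have : (mordellTwist Δ).Δ = -(432 * (1728 * (Δ : ℚ)) ^ 2) := by
      simp only [mordellTwist, WeierstrassCurve.Δ, WeierstrassCurve.b₂, WeierstrassCurve.b₄,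
        WeierstrassCurve.b₆, WeierstrassCurve.b₈]
      ring
    change (mordellTwist Δ).Δ ≠ 0
    rw [this]
    have hq : (Δ : ℚ) ≠ 0 := by exact_mod_cast hΔ0
    exact neg_ne_zero.mpr (by positivity)
  have hP : (mordellTwist Δ).toAffine.Nonsingular (x : ℚ) (y : ℚ) :=
    ((mordellTwist Δ).toAffine.equation_iff_nonsingular_of_Δ_ne_zero hD).mp hxy
  exact hC Δ hsq x y hP

end Summit.ABC.ABC.Cruxes.ThinWeightedSzpiro.MordellRankGate

/-! ## Planner-facing: the Frey-class restriction of the crux (typed re-cut) -/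

namespace Summit.ABC.ABC.Cruxes.ThinWeightedSzpiro.FreyRecut

open WeierstrassCurve IsDedekindDomain
open Summit.ABC.ABC.Theses.RibetTakahashiSplit
open Literature.NumberTheory.EllipticCurves

/-- r3″ restricted to the twisted Frey–Hellegouarch class (the hypothesis of
`ManyPrimeValuationProductSemistableFrey`, verbatim) — the only instance the route's `closes`
instantiates; Frey minimal models never meet the squarefree slice (`ord_p Δ_min = 2 v_p(abc) ≥ 2`
at every odd bad prime), so the class-free Hall kernel of r3″ is absent here. -/
def FreyThinWeightedSzpiro : Prop :=
  ∃ θ : ℝ, 0 < θ ∧ ∀ ε : ℝ, 0 < ε → ∀ K : ℝ, ∃ C : ℝ, ∀ W₀ : WeierstrassCurve ℤ,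
    (W₀.baseChange ℚ).IsElliptic →
    (∀ v : HeightOneSpectrum ℤ, (W₀.baseChange ℚ).IsMinimalAt v) →
    (∀ p : ℕ, p.Prime → p ≠ 2 → ¬ p ^ 2 ∣ (W₀.baseChange ℚ).conductorNorm ℤ) →
    (∃ (a b d : ℤ) (C' : VariableChange ℚ), IsCoprime a b ∧ a * b * (a + b) ≠ 0 ∧ d ∣ 2 ∧
      C' • (W₀.baseChange ℚ) = freyCurve (d * a) (d * b)) →
    ((∏ p ∈ ((W₀.baseChange ℚ).conductorNorm ℤ).primeFactors with
        ¬ p ^ 2 ∣ (W₀.baseChange ℚ).conductorNorm ℤ,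
        ((W₀.baseChange ℚ).minimalDiscriminantNorm ℤ).factorization p : ℕ) : ℝ) ≤
      K * (((W₀.baseChange ℚ).conductorNorm ℤ : ℕ) : ℝ) ^ θ →
    ((max |W₀.Δ| (|W₀.c₄| ^ 3) : ℤ) : ℝ) ≤
      C * ((((W₀.baseChange ℚ).conductorNorm ℤ : ℕ) : ℝ) *
        ((∏ p ∈ ((W₀.baseChange ℚ).conductorNorm ℤ).primeFactors with
            ¬ p ^ 2 ∣ (W₀.baseChange ℚ).conductorNorm ℤ,
            ((W₀.baseChange ℚ).minimalDiscriminantNorm ℤ).factorization p : ℕ) : ℝ)) ^ (6 + ε)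

/-- The crux implies its Frey-class restriction (drop one hypothesis). -/
theorem frey_of_crux (h : ThinWeightedSzpiro) : FreyThinWeightedSzpiro := by
  obtain ⟨θ, hθ, hT⟩ := h
  refine ⟨θ, hθ, fun ε hε K => ?_⟩
  obtain ⟨C, hC⟩ := hT ε hε K
  exact ⟨C, fun W₀ hE hmin hss _hfrey hthin => hC W₀ hE hmin hss hthin⟩

/-- The re-pointed deciding theorem the planner would certify after a re-cut (`route edit --restate
ThinWeightedSzpiro` to the Frey class, or a new item + `--closes-file`): its proof is the refuter's
`IdleProbe.abc_of_r2SF_of_thin` (evidence Idle.lean, 2026-08-17T09:48Z; = the dropped glue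
`ThinFreyTransfer` + `AbcSixteenReduction.abcLe_of_abcLe_sixteen_dvd` + the ω-lift
`OmegaLiftAssemblyLift.abc_of_manyOddPrimes`), with the Frey witness of
`ThinFreyTransfer.exists_semistable_minimal_frey_model` passed to the restricted crux. -/
def FreyRecutCloses : Prop :=
  ManyPrimeValuationProductSemistableFrey → FreyThinWeightedSzpiro → _root_.ABC

end Summit.ABC.ABC.Cruxes.ThinWeightedSzpiro.FreyRecut
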